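import Mathlib
import Literature.Analysis.FluidPDE.WeaklyHarmonicOscillation
import Literature.Analysis.FluidPDE.ClassicalSolutionCalculus
import Literature.Analysis.FluidPDE.HelmholtzAnnihilator
import HarnessLib

/-!
# Slice pressure, the harmonic step (crux `FarPastLedger`, line `uloc-gronwall-transplant`)

Helper file for the lead's stub `stub_fplSlicePressure` of crux stmt-NavierStokesRegularity-14060
(`SymmetryModuliCount.FarPastLedger`): scale-invariant interior estimates for CLASSICALLY
harmonic functions on a ball of `ℝ³`, from the tree's weakly-harmonic Lipschitz representative
(`exists_lipschitz_rep_of_weaklyHarmonic_scale`, Gilbarg–Trudinger Thm 2.10):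

* `fpl_exists_gradient_bound_harmonic` — `‖DH(x)‖ ≤ K ρ⁻⁴ ∫_{B(c,ρ)} |H|` on `B(c, ρ/2)`;
* `fpl_exists_gradient_osc_harmonic` — `‖DH(x) - DH(c)‖ ≤ K' ρ⁻⁵ (∫_{B(c,ρ)} |H|) |x - c|` on
  `B(c, ρ/4)` (the first bound applied to the harmonic directional derivatives `∂ₑH` on
  `B(c, ρ/2)`, then the mean value inequality).

In the line, `H = q - p₁ - Q_ρ` is harmonic on `B(x₀, ρ)` with `∫_{B_ρ}|H| = O(ρ⁴)`, so its
gradient is asymptotically constant on `B(x₀, 2)` as `ρ → ∞`: the affine pressure mode.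
-/

noncomputable section

open MeasureTheory Set Filter Metric Topology
open scoped ContDiff Laplacian RealInnerProductSpace

set_option linter.dupNamespace false -- nested layout Summit.<S>.<Sub>, Sub = S (D-0017)

namespace Summit.NavierStokesRegularity.NavierStokesRegularity.Theorems

open Literature.Analysis.FluidPDE

/-! ### Classical harmonic functions are weakly harmonic -/

/-- A `C²` function with `ΔH = 0` on `B(c, ρ)` is weakly harmonic there:
`∫ H Δφ = 0` for every test function supported in the ball (Green's second identity). -/
theorem fpl_weaklyHarmonic_of_laplacian_eq_zero {H : EuclideanSpace ℝ (Fin 3) → ℝ}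
    (hH : ContDiff ℝ 2 H) {c : EuclideanSpace ℝ (Fin 3)} {ρ : ℝ}
    (hΔ : ∀ y ∈ ball c ρ, (Δ H) y = 0) (φ : EuclideanSpace ℝ (Fin 3) → ℝ)
    (hφ : ContDiff ℝ (⊤ : ℕ∞) φ) (hφc : HasCompactSupport φ) (hsupp : tsupport φ ⊆ ball c ρ) :
    ∫ x, H x * (Δ φ) x = 0 := by
  have hφ2 : ContDiff ℝ 2 φ := hφ.of_le (by norm_cast)
  have key := integral_inner_laplacian_comm (F' := ℝ) hH hφ2 hφc
  have e1 : ∫ x, ⟪(Δ H) x, φ x⟫ = 0 := by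
    refine integral_eq_zero_of_ae (Eventually.of_forall fun x => ?_)
    by_cases hx : x ∈ tsupport φ
    · simp [hΔ x (hsupp hx)]
    · simp [image_eq_zero_of_notMem_tsupport hx]
  have e2 : ∫ x, ⟪H x, (Δ φ) x⟫ = ∫ x, H x * (Δ φ) x :=
    integral_congr_ae (Eventually.of_forall fun x => by simp [mul_comm])
  rw [← e2, ← key, e1]

/-! ### The gradient bound on `B(c, ρ/2)` -/

/-- **Interior gradient bound for harmonic functions, scale-invariant form**: there is an absolute
`K ≥ 0` such that every `H ∈ C²(ℝ³)` harmonic on `B(c, ρ)` satisfies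
`‖DH(x)‖ ≤ K ρ⁻⁴ ∫_{B(c,ρ)} |H|` for `x ∈ B(c, ρ/2)`. -/
theorem fpl_exists_gradient_bound_harmonic :
    ∃ K : ℝ, 0 ≤ K ∧ ∀ (H : EuclideanSpace ℝ (Fin 3) → ℝ), ContDiff ℝ 2 H →
      ∀ (c : EuclideanSpace ℝ (Fin 3)) (ρ : ℝ), 0 < ρ → (∀ y ∈ ball c ρ, (Δ H) y = 0) →
      ∀ x ∈ ball c (ρ / 2), ‖fderiv ℝ H x‖ ≤ K * (ρ ^ 4)⁻¹ * ∫ y in ball c ρ, |H y| := by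
  obtain ⟨K, hK0, hK⟩ := exists_lipschitz_rep_of_weaklyHarmonic_scale
  refine ⟨K, hK0, fun H hH c ρ hρ hΔ x hx => ?_⟩
  have hHc : Continuous H := hH.continuous
  have hint : IntegrableOn H (ball c ρ) volume :=
    (hHc.continuousOn.integrableOn_compact (isCompact_closedBall c ρ)).mono_set ball_subset_closedBall
  obtain ⟨H', hH'c, hae, hlip⟩ := hK c ρ H hρ hint
    (fun φ hφ hφc hsupp => fpl_weaklyHarmonic_of_laplacian_eq_zero hH hΔ φ hφ hφc hsupp)
  -- `H = H'` on the open ball `B(c, ρ/2)`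
  have heq : EqOn H H' (ball c (ρ / 2)) :=
    Measure.eqOn_open_of_ae_eq hae isOpen_ball hHc.continuousOn hH'c.continuousOn
  -- the Lipschitz constant of `H'`
  set L : ℝ := K * (ρ ^ 4)⁻¹ * ∫ y in ball c ρ, |H y| with hL
  have hL0 : 0 ≤ L := by
    have : 0 ≤ ∫ y in ball c ρ, |H y| := integral_nonneg fun y => abs_nonneg _
    positivity
  have hlipW : LipschitzWith (Real.toNNReal L) H' := by
    refine LipschitzWith.of_dist_le_mul fun x z => ?_
    rw [Real.dist_eq, dist_eq_norm, Real.coe_toNNReal _ hL0]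
    exact hlip x z
  -- `fderiv H x = fderiv H' x`
  have hev : H =ᶠ[𝓝 x] H' := by
    filter_upwards [isOpen_ball.mem_nhds hx] with z hz
    exact heq hz
  rw [hev.fderiv_eq]
  have h := norm_fderiv_le_of_lipschitz ℝ hlipW (x₀ := x)
  rwa [Real.coe_toNNReal _ hL0] at h

/-! ### The gradient oscillation bound on `B(c, ρ/4)` -/

/-- Directional derivatives of a `C³` function harmonic on a ball are harmonic there. -/
theorem fpl_laplacian_fderiv_apply_eq_zero {H : EuclideanSpace ℝ (Fin 3) → ℝ}
    (hH : ContDiff ℝ 3 H) {c : EuclideanSpace ℝ (Fin 3)} {ρ : ℝ}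
    (hΔ : ∀ y ∈ ball c ρ, (Δ H) y = 0) (e : EuclideanSpace ℝ (Fin 3)) {y : EuclideanSpace ℝ (Fin 3)}
    (hy : y ∈ ball c ρ) : (Δ (fun z => fderiv ℝ H z e)) y = 0 := by
  rw [← fderiv_laplacian_apply hH y e]
  have hev : (Δ H) =ᶠ[𝓝 y] fun _ => (0 : ℝ) := by
    filter_upwards [isOpen_ball.mem_nhds hy] with z hz
    exact hΔ z hz
  rw [hev.fderiv_eq]
  simp

/-- **Interior gradient OSCILLATION bound for harmonic functions**: there is an absolute `K' ≥ 0`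
such that every `H ∈ C³(ℝ³)` harmonic on `B(c, ρ)` satisfies
`‖DH(x) - DH(c)‖ ≤ K' ρ⁻⁵ (∫_{B(c,ρ)} |H|) ‖x - c‖` for `x ∈ B(c, ρ/4)`. -/
theorem fpl_exists_gradient_osc_harmonic :
    ∃ K' : ℝ, 0 ≤ K' ∧ ∀ (H : EuclideanSpace ℝ (Fin 3) → ℝ), ContDiff ℝ 3 H →
      ∀ (c : EuclideanSpace ℝ (Fin 3)) (ρ : ℝ), 0 < ρ →
      (∀ y ∈ Metric.ball c ρ, Laplacian.laplacian H y = 0) → ∀ x ∈ Metric.ball c (ρ / 4),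
        ‖fderiv ℝ H x - fderiv ℝ H c‖ ≤ K' * (ρ ^ 5)⁻¹ * (∫ y in Metric.ball c ρ, |H y|) * ‖x - c‖ := by
  obtain ⟨K, hK0, hK⟩ := fpl_exists_gradient_bound_harmonic
  set V : ℝ := (volume (ball (0 : EuclideanSpace ℝ (Fin 3)) 1)).toReal with hV
  have hV0 : 0 ≤ V := ENNReal.toReal_nonneg
  refine ⟨2 * K ^ 2 * V, by positivity, fun H hH c ρ hρ hΔ x hx => ?_⟩
  have hH2 : ContDiff ℝ 2 H := hH.of_le (by norm_num)
  set I : ℝ := ∫ y in ball c ρ, |H y| with hI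
  have hI0 : 0 ≤ I := integral_nonneg fun y => abs_nonneg _
  -- gradient bound on `B(c, ρ/2)`
  have hgrad : ∀ y ∈ ball c (ρ / 2), ‖fderiv ℝ H y‖ ≤ K * (ρ ^ 4)⁻¹ * I :=
    fun y hy => hK H hH2 c ρ hρ hΔ y hy
  -- the directional derivatives
  have hGd : ∀ e : EuclideanSpace ℝ (Fin 3), ContDiff ℝ 2 (fun z => fderiv ℝ H z e) := fun e =>
    (hH.fderiv_right (m := 2) le_rfl).clm_apply contDiff_const
  have hGharm : ∀ e : EuclideanSpace ℝ (Fin 3), ∀ y ∈ ball c (ρ / 2),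
      (Δ (fun z => fderiv ℝ H z e)) y = 0 := fun e y hy =>
    fpl_laplacian_fderiv_apply_eq_zero hH hΔ e (ball_subset_ball (by linarith) hy)
  -- gradient bound for `∂ₑH` on `B(c, ρ/4)`
  have hρ2 : 0 < ρ / 2 := by linarith
  have hGgrad : ∀ e : EuclideanSpace ℝ (Fin 3), ∀ y ∈ ball c (ρ / 4),
      ‖fderiv ℝ (fun z => fderiv ℝ H z e) y‖ ≤
        K * ((ρ / 2) ^ 4)⁻¹ * ∫ z in ball c (ρ / 2), |fderiv ℝ H z e| := by
    intro e y hy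
    have hy' : y ∈ ball c (ρ / 2 / 2) := by rwa [show ρ / 2 / 2 = ρ / 4 by ring]
    exact hK _ (hGd e) c (ρ / 2) hρ2 (hGharm e) y hy'
  -- `∫_{B(c,ρ/2)} |∂ₑH| ≤ |B_{ρ/2}| K ρ⁻⁴ I ‖e‖`
  have hvol : (volume (ball c (ρ / 2))).toReal = (ρ / 2) ^ 3 * V := by
    rw [hV, Measure.addHaar_ball volume c hρ2.le, ENNReal.toReal_mul, finrank_euclideanSpace_fin,
      ENNReal.toReal_ofReal (by positivity)]
  have hIe : ∀ e : EuclideanSpace ℝ (Fin 3), ∫ z in ball c (ρ / 2), |fderiv ℝ H z e| ≤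
      (ρ / 2) ^ 3 * V * (K * (ρ ^ 4)⁻¹ * I * ‖e‖) := by
    intro e
    have hb : ∀ z ∈ ball c (ρ / 2), |fderiv ℝ H z e| ≤ K * (ρ ^ 4)⁻¹ * I * ‖e‖ := by
      intro z hz
      rw [← Real.norm_eq_abs]
      calc ‖fderiv ℝ H z e‖ ≤ ‖fderiv ℝ H z‖ * ‖e‖ := ContinuousLinearMap.le_opNorm _ _
        _ ≤ K * (ρ ^ 4)⁻¹ * I * ‖e‖ := mul_le_mul_of_nonneg_right (hgrad z hz) (norm_nonneg _)
    calc ∫ z in ball c (ρ / 2), |fderiv ℝ H z e|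
        ≤ ∫ _z in ball c (ρ / 2), K * (ρ ^ 4)⁻¹ * I * ‖e‖ := by
          refine setIntegral_mono_on ?_ (integrableOn_const measure_ball_lt_top.ne)
            measurableSet_ball hb
          have hc' : Continuous fun z => |fderiv ℝ H z e| :=
            (continuous_abs.comp ((hGd e).continuous))
          exact (hc'.continuousOn.integrableOn_compact (isCompact_closedBall c (ρ / 2))).mono_set
            ball_subset_closedBall
      _ = (ρ / 2) ^ 3 * V * (K * (ρ ^ 4)⁻¹ * I * ‖e‖) := by
          rw [setIntegral_const, smul_eq_mul, measureReal_def, hvol]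
  -- pointwise bound for `D(∂ₑH)` on the convex ball `B(c, ρ/4)`
  have hD2 : ∀ e : EuclideanSpace ℝ (Fin 3), ∀ y ∈ ball c (ρ / 4),
      ‖fderiv ℝ (fun z => fderiv ℝ H z e) y‖ ≤ 2 * K ^ 2 * V * (ρ ^ 5)⁻¹ * I * ‖e‖ := by
    intro e y hy
    refine (hGgrad e y hy).trans ?_
    have h16 : ((ρ / 2) ^ 4)⁻¹ = 16 * (ρ ^ 4)⁻¹ := by
      rw [div_pow]; field_simp; norm_num
    rw [h16]
    calc K * (16 * (ρ ^ 4)⁻¹) * ∫ z in ball c (ρ / 2), |fderiv ℝ H z e|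
        ≤ K * (16 * (ρ ^ 4)⁻¹) * ((ρ / 2) ^ 3 * V * (K * (ρ ^ 4)⁻¹ * I * ‖e‖)) :=
          mul_le_mul_of_nonneg_left (hIe e) (by positivity)
      _ = 2 * K ^ 2 * V * (ρ ^ 5)⁻¹ * I * ‖e‖ := by
          field_simp
          ring
  -- mean value inequality for `∂ₑH` between `c` and `x`
  have hMV : ∀ e : EuclideanSpace ℝ (Fin 3),
      ‖fderiv ℝ H x e - fderiv ℝ H c e‖ ≤ 2 * K ^ 2 * V * (ρ ^ 5)⁻¹ * I * ‖e‖ * ‖x - c‖ := by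
    intro e
    have hconv : Convex ℝ (ball c (ρ / 4)) := convex_ball c (ρ / 4)
    have hdiff : ∀ y ∈ ball c (ρ / 4), DifferentiableAt ℝ (fun z => fderiv ℝ H z e) y := fun y _ =>
      ((hGd e).differentiable (by norm_num)) y
    have hc4 : c ∈ ball c (ρ / 4) := mem_ball_self (by linarith)
    exact hconv.norm_image_sub_le_of_norm_fderiv_le (fun y hy => hdiff y hy) (hD2 e) hc4 hx
  -- pass to the operator norm
  refine ContinuousLinearMap.opNorm_le_bound _ (by positivity) fun e => ?_
  rw [sub_apply]
  calc ‖fderiv ℝ H x e - fderiv ℝ H c e‖ ≤ 2 * K ^ 2 * V * (ρ ^ 5)⁻¹ * I * ‖e‖ * ‖x - c‖ := hMV e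
    _ = 2 * K ^ 2 * V * (ρ ^ 5)⁻¹ * I * ‖x - c‖ * ‖e‖ := by ring

end Summit.NavierStokesRegularity.NavierStokesRegularity.Theorems

end
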